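import Summits.AtomisticToContinuum.Crystallization.Theorems.FrustratedLawDichotomyStrainedPatchHomExteriorCellBacked

/-!
# The v2 EXTERIOR and ANNULUS leaf soundness WITHOUT shuffle signs (27623 `(H) HomFloor (1/625)`, hcp half)

decomp-a2c lens-5 g88, FILE C1 of NODE 88's port (crux `AperiodicFrustratedLawGap`, stmt-AtomisticToContinuum-27623; item R3 of the node memo §5).
Imports ONLY the tree (`…HomExteriorCellBacked`); no quotient notion is needed here — this file can land independently of the node.

* `exteriorOK2_soundQ`, `annulusOK2_soundQ`: the tree's `…ExteriorLeafV2.exteriorOK2_sound` / `…ExteriorAnnulusV2.annulusOK2_sound` with their two UNUSED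
  sign binders `(_h0 : 0 ≤ ξ 0) (_h2 : 0 ≤ ξ 2)` deleted — statements otherwise identical, proofs VERBATIM (ray domination never used the shuffle signs).
  Consumed by FILE C2 `…HomEntrySemanticQuotColumn` (the quotient column), which turns them into `semOKHQ` facts.

Soundness theorems only; complete proofs, no placeholders; standard axioms; additive (nothing landed is modified); nothing is kernel-evaluated here.
`--supports stmt-AtomisticToContinuum-27623`.
-/

noncomputable section

open Set

namespace Summit.AtomisticToContinuum.Crystallization.Theorems.FrustratedLawDichotomyStrainedPatchHomExteriorRay

open scoped BigOperators RealInnerProductSpace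
open Literature.Analysis.ValidatedNumerics.Numerics
open Summit.AtomisticToContinuum.Crystallization.Theorems.ChargedEnergyGapNegative (E3)
open Summit.AtomisticToContinuum.Crystallization.Theorems.FrustratedLawDichotomySchurCut (effPot w₄₅ ω₄)
open Summit.AtomisticToContinuum.Crystallization.Theorems.FrustratedLawDichotomyAveragingRuleTightFree (TightNearCap BadNearCap)
open Summit.AtomisticToContinuum.Crystallization.Theorems.FrustratedLawDichotomyExemptAbsorption (ExemptNear)
open Summit.AtomisticToContinuum.Crystallization.Theorems.FrustratedLawDichotomyStrainedPatchHomSplit (ExRec latPt hexFrame hcpShift)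
open Summit.AtomisticToContinuum.Crystallization.Theorems.FrustratedLawDichotomyStrainedPatchTaylorChord (segGd)
open Summit.AtomisticToContinuum.Crystallization.Theorems.FrustratedLawDichotomyStrainedPatchHomCurvLeaf (nodup_filter_append toFinset_filter_append)
open Summit.AtomisticToContinuum.Crystallization.Theorems.FrustratedLawDichotomyStrainedPatchHomCurvLJ (curvCheckLJM ljLabelOK)
open Summit.AtomisticToContinuum.Crystallization.Theorems.FrustratedLawDichotomyStrainedPatchHomForceJacN (fjQ boxLabels11 boxLabels11_toFinset)
open Summit.AtomisticToContinuum.Crystallization.Theorems.FrustratedLawDichotomyStrainedPatchHomForceHcp (xiBallOK norm_le_quarter_of_xiBallOK)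
open Summit.AtomisticToContinuum.Crystallization.Theorems.FrustratedLawDichotomyStrainedPatchHomSlopeLJAffine (affShuf abs_affShuf_sub_le jw)
open Summit.AtomisticToContinuum.Crystallization.Theorems.FrustratedLawDichotomyStrainedPatchHomEntryLeafHT (htBU htRU htUniv htIn htK htROKU htBU_nodup
  htNaiOKA2 htGsA2 refForce_chunkA2_le jacOK jacOK_spec norm_le_seven_of_htIn lo_le_of_norm_le_seven six_le_norm_of_lo seven_lt_norm_of_not_mem_htUniv
  mem_boxLabels11_of_mem_htUniv mem_htUniv_of_mem_htBU htIn_of_mem_htBU mem_htBU_of_htIn)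
open Summit.AtomisticToContinuum.Crystallization.Theorems.FrustratedLawDichotomyStrainedPatchHomEntryLeafHT (semOKH semOKH_anti_box semOKH_forall semOKH_of_forall
  hcpCoord HcpLeafGoal inHcpBox_iff)
open Summit.AtomisticToContinuum.Crystallization.Theorems.FrustratedLawDichotomyStrainedPatchHomEntryGramHcp (rootCH rootWH)
open Summit.AtomisticToContinuum.Crystallization.Theorems.FrustratedLawDichotomyStrainedPatchHomForceCentredHcp (entryLeafOKHC)
open Summit.AtomisticToContinuum.Crystallization.Theorems.FrustratedLawDichotomyStrainedPatchHomLatticeBox (norm_apply_ge_of_near_one)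
open Summit.AtomisticToContinuum.Crystallization.Theorems.FrustratedLawDichotomyStrainedPatchHomCutTree (CutTree cutOK coveredAt coveredAt_sound
  semOKH_of_cutOK_leaves semOKH_of_entryLeafOKHC_level)

/-! ## §1. The v2 exterior slab leaf -/

/-- ★★★ **SOUNDNESS OF THE EXTERIOR SLAB LEAF v2 in the full `hver` shape, at EVERY level `μ`.** [folklore chaining: v1's proof with `floorOK_sound` and the gap measured
from the reference range `jwBox J wC`] -/
theorem exteriorOK2_soundQ {μ : ℤ} {J : Fin 3 → Fin 3 × Fin 3 → ℤ} {cC wC cH wH : Bx} {ch : List (Bx × Bx × (Fin 3 → Fin 3 → ℤ) × ℤ)} {lmin g : ℤ} {i : Fin 3}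
    {c w : Bx} (h : exteriorOK2 J cC wC cH wH ch lmin g i c w = true) (U : E3 →L[ℝ] E3) (ξ : E3)
    (_hsa : ∀ v v' : E3, ⟪U v, v'⟫ = ⟪v, U v'⟫) (hU : ‖U - 1‖ ≤ 1 / 4)
    (hbox : ∀ ab : Fin 3 × Fin 3, |(U (EuclideanSpace.single ab.2 (1 : ℝ))) ab.1 - (c (Sum.inl ab) : ℝ) / SC| ≤ (w (Sum.inl ab) : ℝ) / SC)
    (hξ : ∀ i : Fin 3, |ξ i - (c (Sum.inr i) : ℝ) / SC| ≤ (w (Sum.inr i) : ℝ) / SC) :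
    (∀ (M : ℕ) (z : Fin M → E3) (cc : Fin M), Function.Injective z →
        Set.range z = {x : E3 | dist x (z cc) ≤ 133 / 10 ∧ ∃ a : Fin 3 → ℤ,
          x = z cc + latPt U hexFrame a ∨ x = z cc + latPt U hexFrame a + U (hcpShift + ξ)} →
        TightNearCap (9 / 5) (3 / 2) z cc ∨ ExemptNear (9 / 5) ExRec z cc ∨ BadNearCap (9 / 5) (3 / 2) z cc) ∨
      (μ : ℝ) / SC ≤ ∑ b ∈ (Fintype.piFinset fun _ : Fin 3 => Finset.Icc (-7 : ℤ) 7).filter (fun b => b ≠ 0), effPot w₄₅ ω₄ (3 / 400) ‖latPt U hexFrame b‖ +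
        ∑ b ∈ (Fintype.piFinset fun _ : Fin 3 => Finset.Icc (-7 : ℤ) 7), effPot w₄₅ ω₄ (3 / 400) ‖latPt U hexFrame b + U (hcpShift + ξ)‖ := by
  classical
  have hS : (0 : ℝ) < SC := SC_pos
  unfold exteriorOK2 extRest2 at h
  simp only [Bool.and_eq_true, decide_eq_true_eq] at h
  obtain ⟨⟨⟨⟨⟨⟨⟨⟨⟨⟨⟨⟨⟨⟨⟨⟨hUC, hUH⟩, hball⟩, hjac⟩, hKlt⟩, hROK⟩, hNai⟩, hlen⟩, hfloors⟩, hgeom⟩, hCH⟩, hSH⟩, hg⟩, hlmin⟩, hgap⟩, hdomZ⟩, hcurvs⟩ := h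
  -- entry boxes
  have hboxC := hbox_of_sameU hUC hbox
  have hboxH := hbox_of_sameU hUH hbox
  -- the reference: the cell's affine sheet point
  set ξ₀ : E3 := affShuf J cC U with hξ₀def
  have hξ₀C : ∀ m : Fin 3, |ξ₀ m - (cC (Sum.inr m) : ℝ) / SC| ≤ (wC (Sum.inr m) : ℝ) / SC := by
    intro m
    refine (abs_affShuf_sub_le (J := J) (w := wC) U hboxC m).trans ?_
    rw [div_le_div_iff_of_pos_right hS]
    exact_mod_cast jacOK_spec hjac m
  have hξ₀J : ∀ m : Fin 3, |ξ₀ m - (cC (Sum.inr m) : ℝ) / SC| ≤ (jwBox J wC (Sum.inr m) : ℝ) / SC :=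
    fun m => abs_affShuf_sub_le (J := J) (w := wC) U hboxC m
  have hξ₀H := hxi_of_xiSub hCH hξ₀C
  have hξH := hxi_of_xiSub hSH hξ
  have hn₀ : ‖ξ₀‖ ≤ 1 / 4 := norm_le_quarter_of_xiBallOK hball hξ₀H
  have hn : ‖ξ‖ ≤ 1 / 4 := norm_le_quarter_of_xiBallOK hball hξH
  -- label finsets from the HULL box (verbatim the cell proof's block at (cH, wH))
  set B : Finset (Fin 3 → ℤ) := (htBU cH wH).toFinset with hBdef
  set R : Finset (Fin 3 → ℤ) := (htRU cH wH).toFinset with hRdef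
  have hB : B ⊆ Fintype.piFinset fun _ : Fin 3 => Finset.Icc (-11 : ℤ) 11 := by
    intro b hb
    rw [← boxLabels11_toFinset]
    exact List.mem_toFinset.2 (mem_boxLabels11_of_mem_htUniv (mem_htUniv_of_mem_htBU (List.mem_toFinset.1 hb)))
  have hBin : ∀ bb ∈ B, ‖latPt U hexFrame bb + U (hcpShift + ξ)‖ ≤ 7 :=
    fun bb hbb => norm_le_seven_of_htIn U hboxH ξ hξH (htIn_of_mem_htBU (List.mem_toFinset.1 hbb))
  have hROK' : ∀ b ∈ htRU cH wH, 36 * (SC : ℤ) ≤ (fjQ cH wH b).lo := by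
    intro b hb
    have := List.all_eq_true.1 hROK b hb
    simpa using this
  have hR : ∀ bb ∈ (Fintype.piFinset fun _ : Fin 3 => Finset.Icc (-11 : ℤ) 11) \ B, ‖latPt U hexFrame bb + U (hcpShift + ξ)‖ ≤ 7 →
      bb ∈ R ∧ 6 ≤ ‖latPt U hexFrame bb + U (hcpShift + ξ)‖ := by
    intro bb hbb h7
    obtain ⟨hbox11, hnotB⟩ := Finset.mem_sdiff.1 hbb
    rw [← boxLabels11_toFinset] at hbox11
    have hbL : bb ∈ boxLabels11 := List.mem_toFinset.1 hbox11
    have hlo := lo_le_of_norm_le_seven U hboxH ξ hξH h7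
    by_cases huniv : bb ∈ htUniv cH wH
    swap
    · exact absurd h7 (not_le.2 (seven_lt_norm_of_not_mem_htUniv U hboxH hξH hKlt hbL huniv))
    by_cases hin : htIn cH wH bb = true
    · exact absurd (List.mem_toFinset.2 (mem_htBU_of_htIn huniv hin)) hnotB
    · have hmemR : bb ∈ htRU cH wH := by
        refine List.mem_filter.2 ⟨huniv, ?_⟩
        simp only [Bool.and_eq_true, Bool.not_eq_true', decide_eq_true_eq]
        exact ⟨by simpa using hin, hlo⟩
      exact ⟨List.mem_toFinset.2 hmemR, six_le_norm_of_lo U hboxH ξ hξH (hROK' bb hmemR)⟩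
  -- the slope bound at the reference over B (second-order centred chunk with L := htBU hull at the CELL box)
  have hf₀ := refForce_chunkA2_le (htBU_nodup cH wH) hNai U hU hboxC (by simpa [hξ₀def] using hn₀) ξ
  rw [← hBdef] at hf₀
  -- the chain
  set m : ℕ := ch.length with hmdef
  have hm : 0 < m := hlen
  simp only [extCurvAll, List.all_eq_true, List.mem_range] at hcurvs
  simp only [extFloorAll, List.all_eq_true, List.mem_range] at hfloors
  simp only [extGeomOK, List.all_eq_true, List.mem_range, Bool.and_eq_true, decide_eq_true_eq] at hgeom
  obtain ⟨⟨⟨hsameK, hC0⟩, hSlast⟩, hnestK⟩ := hgeom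
  have hLB : ∀ k, k < m → ((htBU cH wH).filter (fun b => ljLabelOK (chC ch k) (chW ch k) b) ++
      (htBU cH wH).filter (fun b => !ljLabelOK (chC ch k) (chW ch k) b)).toFinset = B :=
    fun k _ => by rw [hBdef]; exact toFinset_filter_append _ _
  have hnd : ∀ k, k < m → ((htBU cH wH).filter (fun b => ljLabelOK (chC ch k) (chW ch k) b) ++
      (htBU cH wH).filter (fun b => !ljLabelOK (chC ch k) (chW ch k) b)).Nodup :=
    fun k _ => nodup_filter_append (htBU_nodup cH wH) _
  have hchk : ∀ k, k < m → curvCheckLJM (chC ch k) (chW ch k) ((htBU cH wH).filter fun b => ljLabelOK (chC ch k) (chW ch k) b)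
      ((htBU cH wH).filter fun b => !ljLabelOK (chC ch k) (chW ch k) b) (chD ch k) (chL ch k) = true :=
    fun k hk => hcurvs k hk
  have hUbox : ∀ k, k < m → ∀ ab : Fin 3 × Fin 3,
      |(U (EuclideanSpace.single ab.2 (1 : ℝ))) ab.1 - (chC ch k (Sum.inl ab) : ℝ) / SC| ≤ (chW ch k (Sum.inl ab) : ℝ) / SC :=
    fun k hk => hbox_of_sameU (hsameK k hk) hbox
  have hnest : ∀ k, k + 1 < m → ∀ j : Fin 3, chC ch (k + 1) (Sum.inr j) - chW ch (k + 1) (Sum.inr j) ≤ chC ch k (Sum.inr j) - chW ch k (Sum.inr j) ∧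
      chC ch k (Sum.inr j) + chW ch k (Sum.inr j) ≤ chC ch (k + 1) (Sum.inr j) + chW ch (k + 1) (Sum.inr j) := by
    intro k hk j
    have h' := hnestK k (by omega) hk
    simp only [xiSub, decide_eq_true_eq] at h'
    exact h' j
  have h0 := hxi_of_xiSub hC0 hξ₀C
  have h1 := hxi_of_xiSub hSlast hξ
  -- the gap: hΔ and the domination
  have hΔ : U (ξ - ξ₀) ≠ 0 := U_sub_ne_zero_of_gap (c₀ := cC) (w₀ := jwBox J wC) hU i hg hξ hξ₀J hgap
  have hℓ : ∀ k, k < m → ((lmin : ℝ) / SC) * ‖U (ξ - ξ₀)‖ ^ 2 ≤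
      (chL ch k : ℝ) / SC * ‖U (ξ - ξ₀)‖ ^ 2 + ∑ i : Fin 3, ∑ j : Fin 3, (chD ch k i j : ℝ) / SC * ((U (ξ - ξ₀)) i * (U (ξ - ξ₀)) j) :=
    fun k hk => floorOK_sound (hfloors k hk) _
  -- the domination inequality from the integers
  have hRcard : (R.card : ℝ) ≤ ((htRU cH wH).length : ℝ) := by
    rw [hRdef]; exact_mod_cast List.toFinset_card_le _
  have hS7 : (6000 / 343 * (7 : ℝ)⁻¹ ^ 4 + 2880 / 49 * (7 : ℝ)⁻¹ ^ 5 + 10 / 7 * (7 : ℝ)⁻¹ ^ 6 + 2 * (7 : ℝ)⁻¹ ^ 7) = 8892 / 823543 := by norm_num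
  have h67 : ((6 : ℝ)⁻¹ ^ 7) = 1 / 279936 := by norm_num
  have hZ : (4 * (SC : ℝ) ^ 2 * 8892 * 279936 + 4 * (SC : ℝ) * (htGsA2 cC wC J (htBU cH wH) : ℝ) * 230539333248 +
      4 * (SC : ℝ) ^ 2 * ((htRU cH wH).length : ℝ) * 823543) < 3 * (lmin : ℝ) * (g : ℝ) * 230539333248 := by exact_mod_cast hdomZ
  have hlmin0 : (0 : ℝ) ≤ (lmin : ℝ) / SC := div_nonneg (by exact_mod_cast hlmin) hS.le
  have hK : (6000 / 343 * (7 : ℝ)⁻¹ ^ 4 + 2880 / 49 * (7 : ℝ)⁻¹ ^ 5 + 10 / 7 * (7 : ℝ)⁻¹ ^ 6 + 2 * (7 : ℝ)⁻¹ ^ 7) +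
      (htGsA2 cC wC J (htBU cH wH) : ℝ) / SC + R.card * (6 : ℝ)⁻¹ ^ 7 < (lmin : ℝ) / SC * (3 / 4 * ((g : ℝ) / SC)) := by
    rw [hS7, h67]
    have hSC : (SC : ℝ) = 281474976710656 := by norm_num [SC]
    rw [hSC] at hZ ⊢
    have hR67 : (R.card : ℝ) * (1 / 279936) ≤ ((htRU cH wH).length : ℝ) * (1 / 279936) := mul_le_mul_of_nonneg_right hRcard (by norm_num)
    nlinarith [hZ, hR67]
  have hdom := dom_of_gap (c₀ := cC) (w₀ := jwBox J wC) hU i hξ hξ₀J hgap hlmin0 hK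
  -- assemble
  exact hver_exterior_of_curvChecks_uniformFloor (μ := μ) hU hn₀ hn B R hB hBin hR hf₀ m hm (chC ch) (chW ch)
    (fun k => (htBU cH wH).filter fun b => ljLabelOK (chC ch k) (chW ch k) b) (fun k => (htBU cH wH).filter fun b => !ljLabelOK (chC ch k) (chW ch k) b)
    (chD ch) (chL ch) hLB hnd hchk hUbox hnest h0 h1 hΔ hℓ hdom

/-! ## §2. The v2 annulus leaf -/

/-- ★★★ **SOUNDNESS OF THE SIGNED-FLOOR EXTERIOR LEAF in the full `hver` shape, at EVERY level `μ`.** [folklore chaining: as `exteriorOK_sound`, ending in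
`hver_exterior_of_curvChecks_signedFloor` with `ℓlo k := ll k/SC`, `a k := na k/den`, `b k := nb k/den`] -/
theorem annulusOK2_soundQ {μ : ℤ} {J : Fin 3 → Fin 3 × Fin 3 → ℤ} {cC wC cH wH : Bx} {ch : List (Bx × Bx × (Fin 3 → Fin 3 → ℤ) × ℤ)} {ll : List ℤ} {den : ℤ}
    {na nb : List ℤ} {g : ℤ} {i : Fin 3} {c w : Bx} (h : annulusOK2 J cC wC cH wH ch ll den na nb g i c w = true) (U : E3 →L[ℝ] E3) (ξ : E3)
    (_hsa : ∀ v v' : E3, ⟪U v, v'⟫ = ⟪v, U v'⟫) (hU : ‖U - 1‖ ≤ 1 / 4)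
    (hbox : ∀ ab : Fin 3 × Fin 3, |(U (EuclideanSpace.single ab.2 (1 : ℝ))) ab.1 - (c (Sum.inl ab) : ℝ) / SC| ≤ (w (Sum.inl ab) : ℝ) / SC)
    (hξ : ∀ i : Fin 3, |ξ i - (c (Sum.inr i) : ℝ) / SC| ≤ (w (Sum.inr i) : ℝ) / SC) :
    (∀ (M : ℕ) (z : Fin M → E3) (cc : Fin M), Function.Injective z →
        Set.range z = {x : E3 | dist x (z cc) ≤ 133 / 10 ∧ ∃ a : Fin 3 → ℤ,
          x = z cc + latPt U hexFrame a ∨ x = z cc + latPt U hexFrame a + U (hcpShift + ξ)} →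
        TightNearCap (9 / 5) (3 / 2) z cc ∨ ExemptNear (9 / 5) ExRec z cc ∨ BadNearCap (9 / 5) (3 / 2) z cc) ∨
      (μ : ℝ) / SC ≤ ∑ b ∈ (Fintype.piFinset fun _ : Fin 3 => Finset.Icc (-7 : ℤ) 7).filter (fun b => b ≠ 0), effPot w₄₅ ω₄ (3 / 400) ‖latPt U hexFrame b‖ +
        ∑ b ∈ (Fintype.piFinset fun _ : Fin 3 => Finset.Icc (-7 : ℤ) 7), effPot w₄₅ ω₄ (3 / 400) ‖latPt U hexFrame b + U (hcpShift + ξ)‖ := by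
  classical
  have hS : (0 : ℝ) < SC := SC_pos
  unfold annulusOK2 annRest2 at h
  simp only [Bool.and_eq_true, decide_eq_true_eq] at h
  obtain ⟨⟨⟨⟨⟨⟨⟨⟨⟨⟨⟨⟨⟨⟨⟨⟨⟨hUC, hUH⟩, hball⟩, hjac⟩, hKlt⟩, hROK⟩, hNai⟩, hlen⟩, hfloors⟩, hgeom⟩, hCH⟩, hSH⟩, hg⟩, hgap⟩, hdwell⟩, hpos⟩, hdomZ⟩, hcurvs⟩ := h
  have hboxC := hbox_of_sameU hUC hbox
  have hboxH := hbox_of_sameU hUH hbox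
  set ξ₀ : E3 := affShuf J cC U with hξ₀def
  have hξ₀C : ∀ m : Fin 3, |ξ₀ m - (cC (Sum.inr m) : ℝ) / SC| ≤ (wC (Sum.inr m) : ℝ) / SC := by
    intro m
    refine (abs_affShuf_sub_le (J := J) (w := wC) U hboxC m).trans ?_
    rw [div_le_div_iff_of_pos_right hS]
    exact_mod_cast jacOK_spec hjac m
  have hξ₀J : ∀ m : Fin 3, |ξ₀ m - (cC (Sum.inr m) : ℝ) / SC| ≤ (jwBox J wC (Sum.inr m) : ℝ) / SC :=
    fun m => abs_affShuf_sub_le (J := J) (w := wC) U hboxC m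
  have hξ₀H := hxi_of_xiSub hCH hξ₀C
  have hξH := hxi_of_xiSub hSH hξ
  have hn₀ : ‖ξ₀‖ ≤ 1 / 4 := norm_le_quarter_of_xiBallOK hball hξ₀H
  have hn : ‖ξ‖ ≤ 1 / 4 := norm_le_quarter_of_xiBallOK hball hξH
  set B : Finset (Fin 3 → ℤ) := (htBU cH wH).toFinset with hBdef
  set R : Finset (Fin 3 → ℤ) := (htRU cH wH).toFinset with hRdef
  have hB : B ⊆ Fintype.piFinset fun _ : Fin 3 => Finset.Icc (-11 : ℤ) 11 := by
    intro b hb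
    rw [← boxLabels11_toFinset]
    exact List.mem_toFinset.2 (mem_boxLabels11_of_mem_htUniv (mem_htUniv_of_mem_htBU (List.mem_toFinset.1 hb)))
  have hBin : ∀ bb ∈ B, ‖latPt U hexFrame bb + U (hcpShift + ξ)‖ ≤ 7 :=
    fun bb hbb => norm_le_seven_of_htIn U hboxH ξ hξH (htIn_of_mem_htBU (List.mem_toFinset.1 hbb))
  have hROK' : ∀ b ∈ htRU cH wH, 36 * (SC : ℤ) ≤ (fjQ cH wH b).lo := by
    intro b hb
    have := List.all_eq_true.1 hROK b hb
    simpa using this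
  have hR : ∀ bb ∈ (Fintype.piFinset fun _ : Fin 3 => Finset.Icc (-11 : ℤ) 11) \ B, ‖latPt U hexFrame bb + U (hcpShift + ξ)‖ ≤ 7 →
      bb ∈ R ∧ 6 ≤ ‖latPt U hexFrame bb + U (hcpShift + ξ)‖ := by
    intro bb hbb h7
    obtain ⟨hbox11, hnotB⟩ := Finset.mem_sdiff.1 hbb
    rw [← boxLabels11_toFinset] at hbox11
    have hbL : bb ∈ boxLabels11 := List.mem_toFinset.1 hbox11
    have hlo := lo_le_of_norm_le_seven U hboxH ξ hξH h7
    by_cases huniv : bb ∈ htUniv cH wH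
    swap
    · exact absurd h7 (not_le.2 (seven_lt_norm_of_not_mem_htUniv U hboxH hξH hKlt hbL huniv))
    by_cases hin : htIn cH wH bb = true
    · exact absurd (List.mem_toFinset.2 (mem_htBU_of_htIn huniv hin)) hnotB
    · have hmemR : bb ∈ htRU cH wH := by
        refine List.mem_filter.2 ⟨huniv, ?_⟩
        simp only [Bool.and_eq_true, Bool.not_eq_true', decide_eq_true_eq]
        exact ⟨by simpa using hin, hlo⟩
      exact ⟨List.mem_toFinset.2 hmemR, six_le_norm_of_lo U hboxH ξ hξH (hROK' bb hmemR)⟩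
  have hf₀ := refForce_chunkA2_le (htBU_nodup cH wH) hNai U hU hboxC (by simpa [hξ₀def] using hn₀) ξ
  rw [← hBdef] at hf₀
  set m : ℕ := ch.length with hmdef
  have hm : 0 < m := hlen
  simp only [extCurvAll, List.all_eq_true, List.mem_range] at hcurvs
  simp only [annFloorAll2, List.all_eq_true, List.mem_range] at hfloors
  simp only [extGeomOK, List.all_eq_true, List.mem_range, Bool.and_eq_true, decide_eq_true_eq] at hgeom
  obtain ⟨⟨⟨hsameK, hC0⟩, hSlast⟩, hnestK⟩ := hgeom
  have hLB : ∀ k, k < m → ((htBU cH wH).filter (fun b => ljLabelOK (chC ch k) (chW ch k) b) ++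
      (htBU cH wH).filter (fun b => !ljLabelOK (chC ch k) (chW ch k) b)).toFinset = B :=
    fun k _ => by rw [hBdef]; exact toFinset_filter_append _ _
  have hnd : ∀ k, k < m → ((htBU cH wH).filter (fun b => ljLabelOK (chC ch k) (chW ch k) b) ++
      (htBU cH wH).filter (fun b => !ljLabelOK (chC ch k) (chW ch k) b)).Nodup :=
    fun k _ => nodup_filter_append (htBU_nodup cH wH) _
  have hchk : ∀ k, k < m → curvCheckLJM (chC ch k) (chW ch k) ((htBU cH wH).filter fun b => ljLabelOK (chC ch k) (chW ch k) b)
      ((htBU cH wH).filter fun b => !ljLabelOK (chC ch k) (chW ch k) b) (chD ch k) (chL ch k) = true :=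
    fun k hk => hcurvs k hk
  have hUbox : ∀ k, k < m → ∀ ab : Fin 3 × Fin 3,
      |(U (EuclideanSpace.single ab.2 (1 : ℝ))) ab.1 - (chC ch k (Sum.inl ab) : ℝ) / SC| ≤ (chW ch k (Sum.inl ab) : ℝ) / SC :=
    fun k hk => hbox_of_sameU (hsameK k hk) hbox
  have hnest : ∀ k, k + 1 < m → ∀ j : Fin 3, chC ch (k + 1) (Sum.inr j) - chW ch (k + 1) (Sum.inr j) ≤ chC ch k (Sum.inr j) - chW ch k (Sum.inr j) ∧
      chC ch k (Sum.inr j) + chW ch k (Sum.inr j) ≤ chC ch (k + 1) (Sum.inr j) + chW ch (k + 1) (Sum.inr j) := by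
    intro k hk j
    have h' := hnestK k (by omega) hk
    simp only [xiSub, decide_eq_true_eq] at h'
    exact h' j
  have h0 := hxi_of_xiSub hC0 hξ₀C
  have h1 := hxi_of_xiSub hSlast hξ
  have hΔ : U (ξ - ξ₀) ≠ 0 := U_sub_ne_zero_of_gap (c₀ := cC) (w₀ := jwBox J wC) hU i hg hξ hξ₀J hgap
  -- per-box signed floors
  have hℓ : ∀ k, k < m → ((zAt ll k : ℝ) / SC) * ‖U (ξ - ξ₀)‖ ^ 2 ≤
      (chL ch k : ℝ) / SC * ‖U (ξ - ξ₀)‖ ^ 2 + ∑ i : Fin 3, ∑ j : Fin 3, (chD ch k i j : ℝ) / SC * ((U (ξ - ξ₀)) i * (U (ξ - ξ₀)) j) :=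
    fun k hk => floorOK_sound (hfloors k hk) _
  -- dwell data
  simp only [dwellOK, Bool.and_eq_true, decide_eq_true_eq, List.all_eq_true, List.mem_range] at hdwell
  obtain ⟨⟨⟨⟨⟨hden, hna0⟩, hnb0⟩, hnam⟩, hnbm⟩, hdw⟩ := hdwell
  have hd : (0 : ℝ) < den := by exact_mod_cast hden
  set a : ℕ → ℝ := fun k => (zAt na k : ℝ) / den with hadef
  set b : ℕ → ℝ := fun k => (zAt nb k : ℝ) / den with hbdef
  have ha0 : a 0 = 0 := by show (zAt na 0 : ℝ) / den = 0; rw [hna0]; simp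
  have hb0 : b 0 = 0 := by show (zAt nb 0 : ℝ) / den = 0; rw [hnb0]; simp
  have ham : a m = 1 := by show (zAt na m : ℝ) / den = 1; rw [hnam]; exact div_self hd.ne'
  have hbm : b m = 1 := by show (zAt nb m : ℝ) / den = 1; rw [hnbm]; exact div_self hd.ne'
  have ha : ∀ k, 1 ≤ k → k < m → a k ∈ Icc (0 : ℝ) 1 ∧
      ∀ j : Fin 3, |(ξ₀ + a k • (ξ - ξ₀)) j - (chC ch (k - 1) (Sum.inr j) : ℝ) / SC| ≤ (chW ch (k - 1) (Sum.inr j) : ℝ) / SC := by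
    intro k hk1 hkm
    obtain ⟨⟨⟨⟨⟨hn0, hn1⟩, hm0⟩, hm1⟩, hmem⟩, _⟩ := hdw k hkm hk1
    refine ⟨⟨div_nonneg (by exact_mod_cast hn0) hd.le, (div_le_one hd).2 (by exact_mod_cast hn1)⟩, fun j => ?_⟩
    rw [rayPoint_coord]
    exact ray_coord_mem_of_check (hξ₀C j) (hξ j) hden hn0 hn1 (hmem j).1 (hmem j).2
  have hb : ∀ k, 1 ≤ k → k < m → b k ∈ Icc (0 : ℝ) 1 ∧
      ∃ j : Fin 3, (chW ch (k - 1) (Sum.inr j) : ℝ) / SC < |(ξ₀ + b k • (ξ - ξ₀)) j - (chC ch (k - 1) (Sum.inr j) : ℝ) / SC| := by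
    intro k hk1 hkm
    obtain ⟨⟨⟨⟨⟨_, _⟩, hm0⟩, hm1⟩, _⟩, ⟨j, hj⟩⟩ := hdw k hkm hk1
    refine ⟨⟨div_nonneg (by exact_mod_cast hm0) hd.le, (div_le_one hd).2 (by exact_mod_cast hm1)⟩, j, ?_⟩
    rw [rayPoint_coord]
    exact ray_coord_not_mem_of_check (hξ₀C j) (hξ j) hden hm0 hm1 hj
  -- the domination
  have hRcard : (R.card : ℝ) ≤ ((htRU cH wH).length : ℝ) := by
    rw [hRdef]; exact_mod_cast List.toFinset_card_le _
  have hS7 : (6000 / 343 * (7 : ℝ)⁻¹ ^ 4 + 2880 / 49 * (7 : ℝ)⁻¹ ^ 5 + 10 / 7 * (7 : ℝ)⁻¹ ^ 6 + 2 * (7 : ℝ)⁻¹ ^ 7) = 8892 / 823543 := by norm_num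
  have h67 : ((6 : ℝ)⁻¹ ^ 7) = 1 / 279936 := by norm_num
  have hsum : (∑ k ∈ Finset.range m, sgnFloor ((zAt ll k : ℝ) / SC) (a k) (b k) (a (k + 1)) (b (k + 1))) =
      (sgnSumZ ll na nb m : ℝ) / (SC * den) := by
    simp only [hadef, hbdef, sgnSumZ]
    push_cast
    rw [Finset.sum_div]
    exact Finset.sum_congr rfl fun k _ => sgnFloorZ_cast _ _ _ _ _ hden
  have hZ : (4 * (SC : ℝ) ^ 2 * den * 8892 * 279936 + 4 * (SC : ℝ) * den * (htGsA2 cC wC J (htBU cH wH) : ℝ) * 230539333248 +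
      4 * (SC : ℝ) ^ 2 * den * ((htRU cH wH).length : ℝ) * 823543) < 3 * (g : ℝ) * 230539333248 * (sgnSumZ ll na nb m : ℝ) := by
    exact_mod_cast hdomZ
  have hposR : (0 : ℝ) < (sgnSumZ ll na nb m : ℝ) := by exact_mod_cast hpos
  have hdom : (6000 / 343 * (7 : ℝ)⁻¹ ^ 4 + 2880 / 49 * (7 : ℝ)⁻¹ ^ 5 + 10 / 7 * (7 : ℝ)⁻¹ ^ 6 + 2 * (7 : ℝ)⁻¹ ^ 7) +
      (htGsA2 cC wC J (htBU cH wH) : ℝ) / SC + R.card * (6 : ℝ)⁻¹ ^ 7 <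
      (∑ k ∈ Finset.range m, sgnFloor ((zAt ll k : ℝ) / SC) (a k) (b k) (a (k + 1)) (b (k + 1))) * ‖U (ξ - ξ₀)‖ := by
    rw [hsum, hS7, h67]
    have hρ := norm_U_sub_ge_of_gap (c₀ := cC) (w₀ := jwBox J wC) hU i hξ hξ₀J hgap
    have hSC : (SC : ℝ) = 281474976710656 := by norm_num [SC]
    have hΛpos : (0 : ℝ) < (sgnSumZ ll na nb m : ℝ) / (SC * den) := div_pos hposR (mul_pos hS hd)
    have hstep : (8892 : ℝ) / 823543 + (htGsA2 cC wC J (htBU cH wH) : ℝ) / SC + ((htRU cH wH).length : ℝ) * (1 / 279936) <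
        (sgnSumZ ll na nb m : ℝ) / (SC * den) * (3 / 4 * ((g : ℝ) / SC)) := by
      rw [← sub_pos]
      have e : (sgnSumZ ll na nb m : ℝ) / (SC * den) * (3 / 4 * ((g : ℝ) / SC)) -
          ((8892 : ℝ) / 823543 + (htGsA2 cC wC J (htBU cH wH) : ℝ) / SC + ((htRU cH wH).length : ℝ) * (1 / 279936)) =
          (3 * (g : ℝ) * 230539333248 * (sgnSumZ ll na nb m : ℝ) - (4 * (SC : ℝ) ^ 2 * den * 8892 * 279936 +
            4 * (SC : ℝ) * den * (htGsA2 cC wC J (htBU cH wH) : ℝ) * 230539333248 + 4 * (SC : ℝ) ^ 2 * den * ((htRU cH wH).length : ℝ) * 823543)) /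
            (4 * (SC : ℝ) ^ 2 * den * 230539333248) := by
        field_simp
        ring
      rw [e]
      exact div_pos (by linarith) (by positivity)
    have hR67 : (R.card : ℝ) * (1 / 279936) ≤ ((htRU cH wH).length : ℝ) * (1 / 279936) := mul_le_mul_of_nonneg_right hRcard (by norm_num)
    calc (8892 : ℝ) / 823543 + (htGsA2 cC wC J (htBU cH wH) : ℝ) / SC + R.card * (1 / 279936)
        ≤ (8892 : ℝ) / 823543 + (htGsA2 cC wC J (htBU cH wH) : ℝ) / SC + ((htRU cH wH).length : ℝ) * (1 / 279936) := by linarith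
      _ < (sgnSumZ ll na nb m : ℝ) / (SC * den) * (3 / 4 * ((g : ℝ) / SC)) := hstep
      _ ≤ (sgnSumZ ll na nb m : ℝ) / (SC * den) * ‖U (ξ - ξ₀)‖ := mul_le_mul_of_nonneg_left hρ hΛpos.le
  exact hver_exterior_of_curvChecks_signedFloor (μ := μ) hU hn₀ hn B R hB hBin hR hf₀ m hm (chC ch) (chW ch)
    (fun k => (htBU cH wH).filter fun b => ljLabelOK (chC ch k) (chW ch k) b) (fun k => (htBU cH wH).filter fun b => !ljLabelOK (chC ch k) (chW ch k) b)
    (chD ch) (chL ch) hLB hnd hchk hUbox hnest h0 h1 hΔ (fun k => (zAt ll k : ℝ) / SC) hℓ a b ha0 hb0 ham hbm ha hb hdom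

end Summit.AtomisticToContinuum.Crystallization.Theorems.FrustratedLawDichotomyStrainedPatchHomExteriorRay

end
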